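import Mathlib.NumberTheory.ArithmeticFunction.Liouville
import Mathlib.NumberTheory.ArithmeticFunction.Moebius
import Mathlib.NumberTheory.ArithmeticFunction.Zeta
import Mathlib.NumberTheory.ArithmeticFunction.Misc
import Mathlib.Analysis.SpecialFunctions.Pow.Real
import Mathlib.Data.Nat.Totient
import Mathlib.NumberTheory.DirichletCharacter.Orthogonality
import Mathlib.RingTheory.RootsOfUnity.AlgebraicallyClosed
import Mathlib.Analysis.Complex.Polynomial.Basic
import HarnessLib

/-!
# Shifted convolutions `∑ f(n) τ(an − h)` for prime-periodic multiplicative `f` (Drappeau–Topacogullari 2019)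

S. Drappeau, B. Topacogullari, *Combinatorial identities and Titchmarsh's divisor problem for
multiplicative functions*, Algebra & Number Theory 13 (2019) 2383–2425
(`DrappeauTopacogullari2019`; held: `lit paper:arxiv-1807.09569`, statements read on PDF pp. 3–5).

The class (p. 3): "Let `A, D ≥ 1` be fixed integers. Define `𝓕_D(A)` to be the set of all
multiplicative functions `f : ℕ → ℂ` which are `D`-periodic over the primes in the sense that
`f(p₁) = f(p₂)` for any primes `p₁` and `p₂` with `p₁ ≡ p₂ mod D`, and which satisfy the growth
condition `|f(n)| ≤ d_A(n)` for all `n ∈ ℕ`, where `d_A(n)` denotes the generalized divisor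
function."  Tree form: `classF D A` (with `divisorPow A = ζ^{*A} = d_A`); the Liouville and Möbius
functions lie in `𝓕₁(1)` (`liouville_mem_classF`, `moebius_mem_classF`, proved).

The results (pp. 3–5):
* **Theorem 1.2 (General shifts).** "Let `A, D, N ≥ 1`. There exists an absolute constant `δ > 0`,
  such that, for all `f ∈ 𝓕_D(A)`, all `x ≥ 2` and all `a, h ∈ ℤ` satisfying `1 ≤ a, |h| ≤ x^δ`,
  we have `∑_{|h|/a < n ≤ x} f(n) d(an − h) = M_f(x; h, a) + O(d((a, h)) x/(log x)^N)`, where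
  `M_f(x; a, h) := 2 ∑_{χ primitive, cond(χ) | D} ∑_{q ≤ √(ax), cond(χ) | q/(q,h)}
  (χ̄(h/(h,q)) / φ(q/(h,q))) ∑_{q²/a ≤ n ≤ x, (an, q) = (h, q)} f(n) χ(an/(an, q))`, and where the
  implied constant depends only on `A`, `D` and `N`."  Theorem 1.1 is its case `a = h = 1`, read
  by the authors as "a result of Bombieri–Vinogradov type 'beyond `√x`' for the average of
  `f ∈ 𝓕_D(A)` in the residue classes of a fixed integer and without absolute values" (p. 3).
* **Theorem 1.3** (case of `d_z`, `|z| ≤ A`): "`∑_{|h| < n ≤ x} d_z(n) d(n + h) =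
  x (log x)^z ∑_{ℓ=0}^N λ_{h,ℓ}(z)/(log x)^ℓ + O(x (log x)^{Re z}/(log x)^{N+1−ε})`" for `x ≥ 2`,
  `1 ≤ |h| ≤ x^δ`, and "if `z` is a non-positive integer, all the coefficients `λ_{h,ℓ}(z)` vanish
  and (1.3) effectively becomes an upper bound"; `d_{−1} = μ` (p. 4: "when `z = −1` for instance,
  we recover the Möbius function `d_{−1}(n) = μ(n)`").

## Tree form (two named facts, D-0014)

* `thm12_conductorOne` — Theorem 1.2 in the case `D = 1` (functions constant on the primes, e.g.
  `λ`, `μ`, `d_z`), where the only primitive character of conductor dividing `1` is the trivial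
  character, so that the main term is the elementary
  `M_f(x; h, a) = 2 ∑_{q ≤ √(ax)} φ(q/(h,q))⁻¹ ∑_{q²/a ≤ n ≤ x, (an,q) = (h,q)} f(n)` (`mainTermOne`);
  quantifiers `∀ A N, ∃ δ > 0, ∃ C` (weaker than the printed absolute `δ`), `a ∈ ℕ`,
  `h ∈ ℤ ∖ {0}` with `a, |h| ≤ x^δ`, `n` ranging over `|h| < an`, `n ≤ x`, so that `an − h ≥ 1`. The general-`D` main term with
  primitive characters is not vendored (no consumer; heavier bookkeeping).
* `thm13_moebius` — Theorem 1.3 at `z = −1`: `∑_{|h| < n ≤ x} μ(n) τ(n + h) ≪_N x/(log x)^N` for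
  `1 ≤ |h| ≤ x^δ` (the printed `O(x (log x)^{−1−(N+1)+ε})` weakened to `C x/(log x)^N`, `x ≥ 2`).

Consumers: route `Summits/Parity/GeneralizedHardyLittlewood/Theses/ShiftedMultiplicationTable.lean`,
item `TypeI2Liouville` (its `R = 1` case: `f = λ ∈ 𝓕₁(1)` in `thm12_conductorOne`; the smallness
`M_λ(x; h, a) ≪ x/(log x)^N` — from the prime number theorem for `λ` on `(n, q) = 1` — is NOT
printed in the source and is left to the consumer). Not here: Theorems 1.4–1.6 (norms, `ω(n) = k`,
Titchmarsh divisor problem), the combinatorial identities of §§2–3.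

## The objects of §2.1 (p. 9): the approximant `τ̃_h(n; R)` and the dispersion sums

The printed proof of Theorem 1.2 runs through **Proposition 2.1** (p. 9), a bound for the sums
`Σ_f(I; a, h; R) = ∑_{n ∈ I} f(n) Δ_h(an; R)`, `Δ_h(n; R) = τ(n − h) − τ̃_h(n; R)`, where
(2.1) `τ̃_h(n; R) := 2 ∑_{q ≤ √(n−h), (n,q) = (h,q)} φ(q/(h,q))⁻¹ ∑_{χ mod q/(h,q), cond(χ) ≤ R}
χ(h/(h,q)) χ̄(n/(h,q))` "should be thought of as an approximation to `τ(n − h)` on average".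
These are vendored as real definitions `dtilde h n R`, `delta h n R`, `sigmaF f y₁ y₂ a h R`
(interval `I = (y₁, y₂]`), with the remark printed after (2.1) — "`τ̃_h(n; R) = τ(n − h)` if
`R > √(n − h)` and `n − h` is not a perfect square" — PROVED in the form
`dtilde_eq_two_mul_card`: for `R ≥ ⌊√(n − h)⌋` every character enters, orthogonality
(`charSum_complete`) turns the `q`-th term into `[q ∣ n − h]`, and
`τ̃_h(n; R) = 2 · #{q ∣ n − h : q² ≤ n − h}` (`= τ(n − h) + [n − h = □]`, see the sibling
`DrappeauTopacogullariProofs`). Proposition 2.1 itself (the core of the paper: §§3–7) is not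
vendored as a fact here (D-0026); the §8 deduction of Theorem 1.2 from it is the next brick.
-/

noncomputable section

open scoped ArithmeticFunction.zeta ArithmeticFunction.sigma ArithmeticFunction.Moebius
open ArithmeticFunction Finset Real

namespace Literature.NumberTheory.Sieve

namespace DrappeauTopacogullari2019

/-! ### The class `𝓕_D(A)` -/

/-- The generalized divisor function `d_A = ζ^{*A}` (`A`-fold Dirichlet convolution of `ζ`, so
`d_1 = 1` on `n ≥ 1` and `d_2 = τ`); the growth majorant of `𝓕_D(A)`.
[cite: DrappeauTopacogullari2019, §1 (definition of 𝓕_D(A), p. 3)] -/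
def divisorPow (A : ℕ) : ArithmeticFunction ℕ :=
  ζ ^ A

/-- `d_1 = ζ`: `d_1(n) = 1` for `n ≥ 1`. [folklore] -/
theorem divisorPow_one : divisorPow 1 = ζ :=
  pow_one _

/-- `d_1(n) = 1` for `n ≠ 0`. [folklore] -/
theorem divisorPow_one_apply {n : ℕ} (hn : n ≠ 0) : divisorPow 1 n = 1 := by
  rw [divisorPow_one, zeta_apply_ne hn]

/-- `d_2 = τ` (number of divisors, `σ₀`). [folklore] -/
theorem divisorPow_two : divisorPow 2 = σ 0 := by
  rw [divisorPow, pow_two, ← zeta_mul_pow_eq_sigma, ArithmeticFunction.pow_zero_eq_zeta]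

/-- **The class `𝓕_D(A)`** of Drappeau–Topacogullari: multiplicative `f : ℕ → ℂ` (as an
arithmetic function, `f(1) = 1`, `f(mn) = f(m) f(n)` for coprime `m, n`), `D`-periodic over the
primes (`f(p₁) = f(p₂)` for primes `p₁ ≡ p₂ mod D`), with `|f(n)| ≤ d_A(n)` for all `n`.
[cite: DrappeauTopacogullari2019, §1 (definition of 𝓕_D(A), p. 3)] -/
def classF (D A : ℕ) : Set (ArithmeticFunction ℂ) :=
  {f | f.IsMultiplicative ∧
    (∀ p₁ p₂ : ℕ, p₁.Prime → p₂.Prime → p₁ ≡ p₂ [MOD D] → f p₁ = f p₂) ∧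
    ∀ n : ℕ, ‖f n‖ ≤ (divisorPow A n : ℝ)}

/-- Membership in `𝓕_D(A)`, unfolded. [folklore] -/
theorem mem_classF_iff (D A : ℕ) (f : ArithmeticFunction ℂ) :
    f ∈ classF D A ↔ f.IsMultiplicative ∧
      (∀ p₁ p₂ : ℕ, p₁.Prime → p₂.Prime → p₁ ≡ p₂ [MOD D] → f p₁ = f p₂) ∧
      ∀ n : ℕ, ‖f n‖ ≤ (divisorPow A n : ℝ) :=
  Iff.rfl

/-- **The Liouville function lies in `𝓕₁(1)`**: completely multiplicative, `λ(p) = −1` on all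
primes, `|λ(n)| ≤ 1 = d_1(n)`. [cite: DrappeauTopacogullari2019, §1 (p. 3)] -/
theorem liouville_mem_classF : ((liouville : ArithmeticFunction ℤ) : ArithmeticFunction ℂ) ∈ classF 1 1 := by
  refine ⟨isMultiplicative_liouville.intCast, ?_, ?_⟩
  · intro p₁ p₂ hp₁ hp₂ _
    simp only [intCoe_apply, liouville_apply hp₁.ne_zero, liouville_apply hp₂.ne_zero,
      cardFactors_apply_prime hp₁, cardFactors_apply_prime hp₂]
  · intro n
    rcases eq_or_ne n 0 with rfl | hn
    · simp
    · rw [intCoe_apply, liouville_apply hn, divisorPow_one_apply hn]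
      simp

/-- **The Möbius function lies in `𝓕₁(1)`** (`μ = d_{−1}`): multiplicative, `μ(p) = −1` on all
primes, `|μ(n)| ≤ 1`. [cite: DrappeauTopacogullari2019, §1.1 (d_{-1} = μ, p. 4)] -/
theorem moebius_mem_classF : ((μ : ArithmeticFunction ℤ) : ArithmeticFunction ℂ) ∈ classF 1 1 := by
  refine ⟨isMultiplicative_moebius.intCast, ?_, ?_⟩
  · intro p₁ p₂ hp₁ hp₂ _
    simp only [intCoe_apply, moebius_apply_prime hp₁, moebius_apply_prime hp₂]
  · intro n
    rcases eq_or_ne n 0 with rfl | hn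
    · simp
    · rw [intCoe_apply, divisorPow_one_apply hn]
      have h := (abs_moebius_le_one (n := n))
      rw [Complex.norm_intCast]
      exact_mod_cast h

/-! ### The sums and the main term at conductor one -/

/-- The shifted convolution sum `S_f(x; h, a) = ∑_{|h|/a < n ≤ x} f(n) τ(an − h)` (`n ≥ 1` integer,
`|h| < an` so that `an − h ≥ 1`; `τ = σ₀`). [cite: DrappeauTopacogullari2019, Theorem 1.2] -/
def shiftedSum (f : ArithmeticFunction ℂ) (x : ℝ) (h : ℤ) (a : ℕ) : ℂ :=
  ∑ n ∈ (Finset.Icc 1 ⌊x⌋₊).filter (fun n : ℕ => h.natAbs < a * n),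
    f n * (σ 0 (Int.toNat ((a : ℤ) * n - h)) : ℂ)

/-- The main term of Theorem 1.2 for `D = 1` (only the trivial character):
`M_f(x; h, a) = 2 ∑_{q ≤ √(ax)} φ(q/(h,q))⁻¹ ∑_{q²/a ≤ n ≤ x, (an, q) = (h, q)} f(n)`, with
`(h, q) = gcd(|h|, q)`. [cite: DrappeauTopacogullari2019, Theorem 1.2 (M_f with D = 1)] -/
def mainTermOne (f : ArithmeticFunction ℂ) (x : ℝ) (h : ℤ) (a : ℕ) : ℂ :=
  2 * ∑ q ∈ Finset.Icc 1 ⌊Real.sqrt (a * x)⌋₊,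
    ((Nat.totient (q / Nat.gcd h.natAbs q) : ℂ)⁻¹ *
      ∑ n ∈ (Finset.Icc 1 ⌊x⌋₊).filter
          (fun n : ℕ => (q : ℝ) ^ 2 / a ≤ (n : ℝ) ∧ Nat.gcd (a * n) q = Nat.gcd h.natAbs q),
        f n)

/-! ### The named facts -/

/-- **Drappeau–Topacogullari 2019, Theorem 1.2 (general shifts), case `D = 1`.** For all
`A, N ≥ 1` there are `δ > 0` and `C` such that for every `f ∈ 𝓕₁(A)` (multiplicative, constant on
the primes, `|f| ≤ d_A`), all `x ≥ 2`, all `a ∈ ℕ`, `h ∈ ℤ` with `1 ≤ a ≤ x^δ`, `1 ≤ |h| ≤ x^δ`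
(the printed "`1 ≤ a, |h| ≤ x^δ`" read as `1 ≤ a` and `1 ≤ |h| ≤ x^δ`, nonzero shifts as in the
abstract and in Theorems 1.3–1.4):
`|∑_{|h|/a < n ≤ x} f(n) τ(an − h) − M_f(x; h, a)| ≤ C τ((a, h)) x/(log x)^N` with the conductor-one
main term `mainTermOne` (printed: "There exists an absolute constant `δ > 0`, such that, for all
`f ∈ 𝓕_D(A)`, all `x ≥ 2` and all `a, h ∈ ℤ` satisfying `1 ≤ a, |h| ≤ x^δ`, we have
`∑_{|h|/a<n≤x} f(n) d(an − h) = M_f(x; h, a) + O(d((a,h)) x/(log x)^N)` … the implied constant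
depends only on `A`, `D` and `N`"; at `D = 1` the character sum in `M_f` reduces to `χ = 1`).
Includes `f = λ` and `f = μ` (`liouville_mem_classF`, `moebius_mem_classF`). Named fact, not
proved here (dispersion method, bounds for sums of Kloosterman sums).
[cite: DrappeauTopacogullari2019, Theorem 1.2] -/
def thm12_conductorOne : Prop :=
  ∀ A N : ℕ, 1 ≤ A → 1 ≤ N → ∃ δ : ℝ, 0 < δ ∧ ∃ C : ℝ, ∀ f ∈ classF 1 A, ∀ x : ℝ, 2 ≤ x →
    ∀ (a : ℕ) (h : ℤ), 1 ≤ a → (a : ℝ) ≤ x ^ δ → h ≠ 0 → (|h| : ℝ) ≤ x ^ δ →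
      ‖shiftedSum f x h a - mainTermOne f x h a‖ ≤
        C * (σ 0 (Nat.gcd a h.natAbs) : ℝ) * x / Real.log x ^ N

/-- **Drappeau–Topacogullari 2019, Theorem 1.3 at `z = −1` (Möbius against shifted divisors, no
main term).** For every `N` there are `δ > 0` and `C` such that for all `x ≥ 2` and all `h ∈ ℤ`
with `1 ≤ |h| ≤ x^δ`: `|∑_{|h| < n ≤ x} μ(n) τ(n + h)| ≤ C x/(log x)^N` (printed:
"`∑_{|h|<n≤x} d_z(n) d(n + h) = x(log x)^z ∑_{ℓ=0}^N λ_{h,ℓ}(z)/(log x)^ℓ +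
O(x (log x)^{Re z}/(log x)^{N+1−ε})`" for `|z| ≤ A`, `x ≥ 2`, `1 ≤ |h| ≤ x^δ`, and "if `z` is a
non-positive integer, all the coefficients `λ_{h,ℓ}(z)` vanish"; `d_{−1} = μ`; the printed
exponent `−1 − (N+1) + ε` is weakened to `−N`). Named fact, not proved here.
[cite: DrappeauTopacogullari2019, Theorem 1.3 (z = −1)] -/
def thm13_moebius : Prop :=
  ∀ N : ℕ, ∃ δ : ℝ, 0 < δ ∧ ∃ C : ℝ, ∀ x : ℝ, 2 ≤ x → ∀ h : ℤ, h ≠ 0 → (|h| : ℝ) ≤ x ^ δ →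
    |∑ n ∈ (Finset.Icc 1 ⌊x⌋₊).filter (fun n : ℕ => h.natAbs < n),
        (μ n : ℝ) * (σ 0 (Int.toNat ((n : ℤ) + h)) : ℝ)| ≤ C * x / Real.log x ^ N

/-! ### The approximant `τ̃_h(n; R)` and the dispersion sums of §2.1 -/

/-- **The approximant `τ̃_h(n; R)`** of Drappeau–Topacogullari (2.1), p. 9: for `n ≥ 1`, `h ∈ ℤ`
with `n − h ≥ 1` and `R ≥ 1`,
`τ̃_h(n; R) := 2 ∑_{q ≤ √(n − h), (n, q) = (h, q)} φ(q/(h,q))⁻¹ ∑_{χ mod q/(h,q), cond(χ) ≤ R}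
  χ(h/(h,q)) χ̄(n/(h,q))`.
Rendering: `q` ranges over `1 ≤ q ≤ ⌊√(n − h)⌋` (`Nat.sqrt`); `(h, q) = gcd(|h|, q)`; the
characters mod `q/(h,q)` are Mathlib's `DirichletCharacter ℂ (q / gcd(|h|, q))` filtered by
`conductor ≤ R`; under `(n, q) = (h, q)` the residue `n/(h,q)` is a unit mod `q/(h,q)`, so the
printed `χ̄(n/(h,q)) = χ(n/(h,q))⁻¹ = χ((n/(h,q))⁻¹)` is written `χ ((n/(h,q))⁻¹)` (inverse in
`ZMod`), the form of Mathlib's orthogonality relation. Junk value `0` when `n ≤ h` (empty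
`q`-range). "The function `τ̃_h(n; R)` should be thought of as an approximation to `τ(n − h)` on
average" (p. 9). [cite: DrappeauTopacogullari2019, §2.1 (2.1), p. 9] -/
def dtilde (h : ℤ) (n : ℕ) (R : ℝ) : ℂ :=
  2 * ∑ q ∈ (Finset.Icc 1 (Nat.sqrt (Int.toNat ((n : ℤ) - h)))).filter
      (fun q : ℕ => Nat.gcd n q = Nat.gcd h.natAbs q),
    ((Nat.totient (q / Nat.gcd h.natAbs q) : ℂ)⁻¹ *
      ∑ χ ∈ (Finset.univ : Finset (DirichletCharacter ℂ (q / Nat.gcd h.natAbs q))).filter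
          (fun χ => (χ.conductor : ℝ) ≤ R),
        χ (((n / Nat.gcd h.natAbs q : ℕ) : ZMod (q / Nat.gcd h.natAbs q)))⁻¹ *
          χ (((h / (Nat.gcd h.natAbs q : ℕ) : ℤ)) : ZMod (q / Nat.gcd h.natAbs q)))

/-- **`Δ_h(n; R) := τ(n − h) − τ̃_h(n; R)`** (Drappeau–Topacogullari, p. 9, display before
Proposition 2.1), with `τ = σ₀` evaluated at the natural number `n − h` (junk `τ(0) = 0` when
`n ≤ h`). [cite: DrappeauTopacogullari2019, §2.1 (definition of Δ_h), p. 9] -/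
def delta (h : ℤ) (n : ℕ) (R : ℝ) : ℂ :=
  (σ 0 (Int.toNat ((n : ℤ) - h)) : ℂ) - dtilde h n R

/-- **The dispersion sum `Σ_f(I; a, h; R) := ∑_{n ∈ I} f(n) Δ_h(an; R)`** of
Drappeau–Topacogullari, p. 9 (display before Proposition 2.1), for the interval `I = (y₁, y₂]`
(integers `n ≥ 1` with `y₁ < n ≤ y₂`; every interval `I ⊂ ℝ₊` of the paper meets `ℕ` in such a
set). Proposition 2.1 (p. 9) is the bound `|Σ_f(I; a, h; R)| ≤ C τ((a,h)) x (log x)^B R^{−1/3}`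
for `x ≥ 3`, `I ⊂ [x/2, x]`, `f ∈ 𝓕_D(A)`, `1 ≤ a, |h|, R ≤ x^δ`.
[cite: DrappeauTopacogullari2019, §2.1 (definition of Σ_f), p. 9] -/
def sigmaF (f : ArithmeticFunction ℂ) (y₁ y₂ : ℝ) (a : ℕ) (h : ℤ) (R : ℝ) : ℂ :=
  ∑ n ∈ (Finset.Icc 1 ⌊y₂⌋₊).filter (fun n : ℕ => y₁ < (n : ℝ)), f n * delta h (a * n) R

/-- Junk range: `τ̃_h(n; R) = 0` when `n ≤ h` (the `q`-range `q ≤ √(n − h)` is empty).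
[folklore] -/
theorem dtilde_eq_zero_of_le {h : ℤ} {n : ℕ} (hnh : (n : ℤ) ≤ h) (R : ℝ) : dtilde h n R = 0 := by
  have h0 : Int.toNat ((n : ℤ) - h) = 0 := Int.toNat_of_nonpos (by linarith)
  simp [dtilde, h0]

/-- **Complete character sums detect congruences** (orthogonality, the mechanism behind the
remark after (2.1)): for `k ≥ 1`, `R ≥ k`, `a` coprime to `k` and `b ∈ ℤ`, every character mod `k`
has conductor `≤ k ≤ R`, and `φ(k)⁻¹ ∑_{χ mod k} χ(a⁻¹) χ(b) = [a ≡ b (mod k)] = [k ∣ b − a]`.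
[folklore] -/
theorem charSum_complete {k : ℕ} (hk : 0 < k) {R : ℝ} (hR : (k : ℝ) ≤ R) (a : ℕ) (b : ℤ)
    (ha : a.Coprime k) :
    ((Nat.totient k : ℂ)⁻¹ *
        ∑ χ ∈ (Finset.univ : Finset (DirichletCharacter ℂ k)).filter
            (fun χ => (χ.conductor : ℝ) ≤ R),
          χ ((a : ZMod k))⁻¹ * χ ((b : ZMod k))) = if (k : ℤ) ∣ b - a then 1 else 0 := by
  haveI : NeZero k := ⟨hk.ne'⟩
  haveI : NeZero ((Monoid.exponent (ZMod k)ˣ : ℕ) : ℂ) :=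
    ⟨Nat.cast_ne_zero.mpr Monoid.exponent_ne_zero_of_finite⟩
  have hfilter : (Finset.univ : Finset (DirichletCharacter ℂ k)).filter
      (fun χ => (χ.conductor : ℝ) ≤ R) = Finset.univ := by
    refine Finset.filter_true_of_mem fun χ _ => ?_
    have h1 : χ.conductor ≤ k := Nat.le_of_dvd hk χ.conductor_dvd_level
    exact le_trans (by exact_mod_cast h1) hR
  rw [hfilter]
  have hunit : IsUnit ((a : ZMod k)) := (ZMod.isUnit_iff_coprime a k).mpr ha
  rw [DirichletCharacter.sum_char_inv_mul_char_eq ℂ hunit]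
  have hiff : ((a : ZMod k) = (b : ZMod k)) ↔ (k : ℤ) ∣ b - a := by
    rw [← ZMod.intCast_eq_intCast_iff_dvd_sub, Int.cast_natCast]
  by_cases hab : (k : ℤ) ∣ b - a
  · rw [if_pos (hiff.mpr hab), if_pos hab]
    have : (Nat.totient k : ℂ) ≠ 0 := by exact_mod_cast (Nat.totient_pos.mpr hk).ne'
    exact inv_mul_cancel₀ this
  · rw [if_neg (fun h' => hab (hiff.mp h')), if_neg hab, mul_zero]

/-- Divisibility bookkeeping for (2.1): if `d ∣ q`, `d ∣ n`, `d ∣ h` (`d ≥ 1`), then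
`q/d ∣ h/d − n/d ↔ q ∣ n − h`. [folklore] -/
theorem dvd_div_sub_div_iff {q n d : ℕ} {h : ℤ} (hd0 : 0 < d) (hdq : d ∣ q) (hdn : d ∣ n)
    (hdh : (d : ℤ) ∣ h) :
    ((q / d : ℕ) : ℤ) ∣ h / (d : ℕ) - ((n / d : ℕ) : ℤ) ↔ (q : ℤ) ∣ (n : ℤ) - h := by
  obtain ⟨q', rfl⟩ := hdq
  obtain ⟨n', rfl⟩ := hdn
  obtain ⟨h', rfl⟩ := hdh
  have hd0' : (d : ℤ) ≠ 0 := by exact_mod_cast hd0.ne'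
  rw [Nat.mul_div_cancel_left _ hd0, Nat.mul_div_cancel_left _ hd0,
    Int.mul_ediv_cancel_left _ hd0', Nat.cast_mul, Nat.cast_mul, ← mul_sub,
    mul_dvd_mul_iff_left hd0', ← dvd_neg (a := (q' : ℤ)) (b := (n' : ℤ) - h'), neg_sub]

/-- **The remark after (2.1), p. 9** ("`τ̃_h(n; R) = τ(n − h)` if `R > √(n − h)` and `n − h` is
not a perfect square"), in exact form: if `R ≥ ⌊√(n − h)⌋` then every character mod `q/(h,q)`,
`q ≤ √(n − h)`, enters the sum (2.1), orthogonality (`charSum_complete`) evaluates the `q`-th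
term to `[q ∣ n − h]` (and `q ∣ n − h` forces `(n, q) = (h, q)`), so that
`τ̃_h(n; R) = 2 · #{q ∣ n − h : q² ≤ n − h}`, which is `τ(n − h) + [n − h is a square]` by the
divisor-pair symmetry (`two_mul_card_divisors_mul_self_le` in the sibling Proofs file). Holds
also in the junk range `n ≤ h` (both sides `0`).
[cite: DrappeauTopacogullari2019, §2.1 remark after (2.1), p. 9] -/
theorem dtilde_eq_two_mul_card {h : ℤ} {n : ℕ} {R : ℝ}
    (hR : (Nat.sqrt (Int.toNat ((n : ℤ) - h)) : ℝ) ≤ R) :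
    dtilde h n R = 2 * (((Nat.divisors (Int.toNat ((n : ℤ) - h))).filter
          (fun q => q * q ≤ Int.toNat ((n : ℤ) - h))).card : ℂ) := by
  set m : ℕ := Int.toNat ((n : ℤ) - h) with hm
  have inner : ∀ q ∈ (Finset.Icc 1 (Nat.sqrt m)).filter
      (fun q : ℕ => Nat.gcd n q = Nat.gcd h.natAbs q),
      ((Nat.totient (q / Nat.gcd h.natAbs q) : ℂ)⁻¹ *
        ∑ χ ∈ (Finset.univ : Finset (DirichletCharacter ℂ (q / Nat.gcd h.natAbs q))).filter
            (fun χ => (χ.conductor : ℝ) ≤ R),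
          χ (((n / Nat.gcd h.natAbs q : ℕ) : ZMod (q / Nat.gcd h.natAbs q)))⁻¹ *
            χ (((h / (Nat.gcd h.natAbs q : ℕ) : ℤ)) : ZMod (q / Nat.gcd h.natAbs q)))
        = if (q : ℤ) ∣ (n : ℤ) - h then 1 else 0 := by
    intro q hq
    simp only [Finset.mem_filter, Finset.mem_Icc] at hq
    obtain ⟨⟨hq1, hqs⟩, hgcd⟩ := hq
    have hd0 : 0 < Nat.gcd h.natAbs q := Nat.gcd_pos_of_pos_right _ hq1
    have hdq : Nat.gcd h.natAbs q ∣ q := Nat.gcd_dvd_right _ _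
    have hdn : Nat.gcd h.natAbs q ∣ n := hgcd ▸ Nat.gcd_dvd_left _ _
    have hdh : ((Nat.gcd h.natAbs q : ℕ) : ℤ) ∣ h := Int.natCast_dvd.mpr (Nat.gcd_dvd_left _ _)
    have hk : 0 < q / Nat.gcd h.natAbs q := Nat.div_pos (Nat.le_of_dvd hq1 hdq) hd0
    have hkR : ((q / Nat.gcd h.natAbs q : ℕ) : ℝ) ≤ R := by
      refine le_trans ?_ hR
      exact_mod_cast le_trans (Nat.div_le_self _ _) hqs
    have hcop : (n / Nat.gcd h.natAbs q).Coprime (q / Nat.gcd h.natAbs q) := by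
      have := Nat.coprime_div_gcd_div_gcd (m := n) (n := q) (hgcd ▸ hd0)
      rwa [hgcd] at this
    rw [charSum_complete hk hkR _ _ hcop]
    exact if_congr (dvd_div_sub_div_iff hd0 hdq hdn hdh) rfl rfl
  unfold dtilde
  rw [Finset.sum_congr rfl inner, ← Finset.sum_filter, Finset.sum_const, nsmul_eq_mul, mul_one,
    Finset.filter_filter]
  congr 2
  have hset : (Finset.Icc 1 (Nat.sqrt m)).filter
      (fun q : ℕ => Nat.gcd n q = Nat.gcd h.natAbs q ∧ (q : ℤ) ∣ (n : ℤ) - h) =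
      (Nat.divisors m).filter (fun q => q * q ≤ m) := by
    ext q
    simp only [Finset.mem_filter, Finset.mem_Icc, Nat.mem_divisors, Nat.le_sqrt]
    constructor
    · rintro ⟨⟨hq1, hqs⟩, -, hdvd⟩
      have hpos : (0 : ℤ) < (n : ℤ) - h := by
        by_contra hle
        push Not at hle
        have : m = 0 := by rw [hm]; exact Int.toNat_of_nonpos hle
        rw [this] at hqs
        have := Nat.mul_pos hq1 hq1
        omega
      have hmz : ((m : ℕ) : ℤ) = (n : ℤ) - h := by rw [hm]; exact Int.toNat_of_nonneg hpos.le
      refine ⟨⟨?_, ?_⟩, hqs⟩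
      · rw [← Int.natCast_dvd_natCast, hmz]; exact hdvd
      · intro h0; rw [h0] at hmz; omega
    · rintro ⟨⟨hqm, hm0⟩, hqs⟩
      have hq1 : 1 ≤ q := Nat.pos_of_ne_zero (fun h0 => hm0 (by simpa [h0] using hqm))
      have hpos : (0 : ℤ) < (n : ℤ) - h := by
        by_contra hle
        push Not at hle
        exact hm0 (by rw [hm]; exact Int.toNat_of_nonpos hle)
      have hmz : ((m : ℕ) : ℤ) = (n : ℤ) - h := by rw [hm]; exact Int.toNat_of_nonneg hpos.le
      have hdvd : (q : ℤ) ∣ (n : ℤ) - h := by rw [← hmz]; exact Int.natCast_dvd_natCast.mpr hqm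
      refine ⟨⟨hq1, hqs⟩, ?_, hdvd⟩
      apply Nat.dvd_antisymm
      · refine Nat.dvd_gcd ?_ (Nat.gcd_dvd_right _ _)
        have h1 : ((Nat.gcd n q : ℕ) : ℤ) ∣ (n : ℤ) :=
          Int.natCast_dvd_natCast.mpr (Nat.gcd_dvd_left _ _)
        have h2 : ((Nat.gcd n q : ℕ) : ℤ) ∣ (n : ℤ) - h :=
          dvd_trans (Int.natCast_dvd_natCast.mpr (Nat.gcd_dvd_right _ _)) hdvd
        have h3 : ((Nat.gcd n q : ℕ) : ℤ) ∣ h := by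
          have := dvd_sub h1 h2; rwa [sub_sub_cancel] at this
        exact Int.natCast_dvd.mp h3
      · refine Nat.dvd_gcd ?_ (Nat.gcd_dvd_right _ _)
        have h1 : ((Nat.gcd h.natAbs q : ℕ) : ℤ) ∣ h := Int.natCast_dvd.mpr (Nat.gcd_dvd_left _ _)
        have h2 : ((Nat.gcd h.natAbs q : ℕ) : ℤ) ∣ (n : ℤ) - h :=
          dvd_trans (Int.natCast_dvd_natCast.mpr (Nat.gcd_dvd_right _ _)) hdvd
        have h3 : ((Nat.gcd h.natAbs q : ℕ) : ℤ) ∣ (n : ℤ) := by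
          have := dvd_add h2 h1; rwa [sub_add_cancel] at this
        exact Int.natCast_dvd_natCast.mp h3
  rw [hset]

end DrappeauTopacogullari2019

end Literature.NumberTheory.Sieve

end
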